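import Summits.Ventures.HodgeRepro2.T5SU11JacobiIntegerWeight
import Summits.Ventures.HodgeRepro2.T5SU11JacobiMonotone
import Summits.Ventures.HodgeRepro2.T5SU11JacobiThreshold

/-!
# The weight `2` (the lowest holomorphic discrete series): `m̂_2(λ) = π²/sin(πλ/2)` on `0 < λ < 2`

The weight `k = 2` is the border case of the discrete series of `SU(1,1)`: its coefficient modulus
`m_2(g) = 1 − |g·0|² = |a(g)|^{-2}` is not integrable (`not_integrable_orbit_rpow_two`, the strip of
`T5SU11JacobiThreshold` is `0 < λ < 2`), yet its Jacobi transform is the simplest of all —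
**`∫_G (1 − |g·0|²) φ_λ(g) dν = π²/sin(πλ/2)`** for `0 < λ < 2` (`integral_orbit_rpow_two_mul_sph`: the
Abel constant is `C_2 = π`, `abel_const_two`, and the Gamma quotient of `T5SU11JacobiTransform` is a bare
reflection product), with the critical value **`m̂_2(1) = π² = C_2²`** (`integral_orbit_rpow_two_mul_sph_one`),
`m̂_2(1/2) = √2 π²` (`integral_orbit_rpow_two_mul_sph_half`), the symmetry `m̂_2(λ) = m̂_2(2 − λ)`
visible in the formula, and poles at both ends of the strip (`tendsto_jacobi_two_nhdsGT_zero_atTop`,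
`tendsto_jacobi_two_nhdsLT_two_atTop`). The `j = 1` case completes the even-weight family of
`T5SU11JacobiIntegerWeight` (stated there for `j ≥ 2`). Nothing is claimed about (N).

Blind lane: Mathlib + the HodgeRepro2 prefix only; no sorry; axioms ⊆ {propext, Classical.choice,
Quot.sound}.
-/

namespace Summit.Ventures.HodgeRepro2.T5SU11JacobiWeightTwo

open MeasureTheory MeasureTheory.Measure Metric Set Filter Topology
open T5SU11Unimodular T5SU11Fibration T5SU11Cartan T5HaarCircle T5BergmanCoefficient
  T5SU11FibrationHaar T5SU11SphericalFunction T5SU11SphericalSymmetry T5SU11JacobiIwasawa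
  T5SU11JacobiTransform T5SU11XiTransform T5SU11JacobiThreshold T5SU11JacobiIntegerWeight
  T5SU11JacobiMonotone
open scoped Real

/-- `C_2 = √π Γ(1/2)/Γ(1) = π`. -/
lemma abel_const_two : √π * Real.Gamma ((2 - 1) / 2) / Real.Gamma (2 / 2) = π := by
  rw [show ((2 : ℝ) - 1) / 2 = 1 / 2 by norm_num, show (2 : ℝ) / 2 = 1 by norm_num, Real.Gamma_one,
    Real.Gamma_one_half_eq, div_one, Real.mul_self_sqrt Real.pi_pos.le]

/-- **The symmetry in the formula**: `π²/sin(πλ/2) = π²/sin(π(2 − λ)/2)`. -/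
theorem weight_two_formula_symm (lam : ℝ) :
    π ^ 2 / Real.sin (π * lam / 2) = π ^ 2 / Real.sin (π * (2 - lam) / 2) := by
  rw [show π * (2 - lam) / 2 = π - π * lam / 2 by ring, Real.sin_pi_sub]

section measure

variable [MeasurableSpace Circle] [BorelSpace Circle]

/-- **The weight-2 transform**: `∫_G (1 − |g·0|²) φ_λ(g) dν = π²/sin(πλ/2)` for `0 < λ < 2`. -/
theorem integral_orbit_rpow_two_mul_sph {lam : ℝ} (h1 : 0 < lam) (h2 : lam < 2) :
    ∫ g, (1 - ‖orbit g‖ ^ 2) ^ ((2 : ℝ) / 2) * sph lam g ∂(nu haarCircle)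
      = π ^ 2 / Real.sin (π * lam / 2) := by
  rw [integral_orbit_rpow_mul_sph (k := 2) (by norm_num) (by linarith) (by linarith), abel_const_two,
    sub_self, Real.rpow_zero, show (2 : ℝ) - 1 = 1 by norm_num, Real.Gamma_one, div_one,
    show (2 - lam) / 2 = 1 - lam / 2 by ring, show (2 + lam) / 2 - 1 = lam / 2 by ring,
    Gamma_mul_Gamma_eq_pi_div_sin]
  ring

/-- **The critical value**: `∫_G (1 − |g·0|²) Ξ(g) dν = π² = C_2²`. -/
theorem integral_orbit_rpow_two_mul_sph_one :
    ∫ g, (1 - ‖orbit g‖ ^ 2) ^ ((2 : ℝ) / 2) * sph 1 g ∂(nu haarCircle) = π ^ 2 := by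
  rw [integral_orbit_rpow_two_mul_sph (by norm_num) (by norm_num), mul_one, Real.sin_pi_div_two, div_one]

/-- The same value from `T5SU11XiTransform.integral_orbit_rpow_mul_sph_one_eq_sq` (`C_2² = π²`). -/
theorem integral_orbit_rpow_two_mul_sph_one' :
    ∫ g, (1 - ‖orbit g‖ ^ 2) ^ ((2 : ℝ) / 2) * sph 1 g ∂(nu haarCircle) = π ^ 2 := by
  rw [integral_orbit_rpow_mul_sph_one_eq_sq (by norm_num), abel_const_two]

/-- `m̂_2(1/2) = √2 π²`. -/
theorem integral_orbit_rpow_two_mul_sph_half :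
    ∫ g, (1 - ‖orbit g‖ ^ 2) ^ ((2 : ℝ) / 2) * sph (1 / 2) g ∂(nu haarCircle) = √2 * π ^ 2 := by
  rw [integral_orbit_rpow_two_mul_sph (by norm_num) (by norm_num),
    show π * (1 / 2) / 2 = π / 4 by ring, Real.sin_pi_div_four]
  have h2 : (0 : ℝ) < √2 / 2 := by positivity
  have h2' : √2 * √2 = 2 := Real.mul_self_sqrt (by norm_num)
  rw [div_eq_iff h2.ne']
  linear_combination (-(π ^ 2) / 2) * h2'

/-- **The weight-2 modulus is not integrable**: `∫_G (1 − |g·0|²) dν = ∞` (the border case of the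
discrete series; `T5SU11JacobiThreshold` at `λ = 0`, `k + λ = 2`). -/
theorem not_integrable_orbit_rpow_two :
    ¬ Integrable (fun g => (1 - ‖orbit g‖ ^ 2) ^ ((2 : ℝ) / 2)) (nu haarCircle) := by
  have h := not_integrable_orbit_rpow_mul_sph (k := 2) (lam := 0) (Or.inr (by norm_num))
  simpa only [sph_zero, mul_one] using h

/-- **Pole at `λ = 0`**: `m̂_2(λ) → +∞` as `λ → 0⁺`. -/
theorem tendsto_jacobi_two_nhdsGT_zero_atTop :
    Tendsto (fun lam => ∫ g, (1 - ‖orbit g‖ ^ 2) ^ ((2 : ℝ) / 2) * sph lam g ∂(nu haarCircle))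
      (𝓝[>] 0) atTop := by
  have h := tendsto_jacobi_nhdsGT_atTop (k := 2) (by norm_num)
  rwa [sub_self] at h

/-- **Pole at `λ = 2`**: `m̂_2(λ) → +∞` as `λ → 2⁻`. -/
theorem tendsto_jacobi_two_nhdsLT_two_atTop :
    Tendsto (fun lam => ∫ g, (1 - ‖orbit g‖ ^ 2) ^ ((2 : ℝ) / 2) * sph lam g ∂(nu haarCircle))
      (𝓝[<] 2) atTop :=
  tendsto_jacobi_nhdsLT_atTop (k := 2) (by norm_num)

end measure

end Summit.Ventures.HodgeRepro2.T5SU11JacobiWeightTwo
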